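import Summits.RiemannHypothesis.RiemannHypothesis.Theorems.WeilGroundStateMarkovPartPositiveGroundStateLsc
import Literature.NumberTheory.LFunctions.WeilOddGroundState
import Literature.Analysis.FunctionSpaces.BMOCarlesonDuality
import Mathlib.Data.Real.Sign

/-!
# Route OddSector, item `OddArchAnchor`: the archimedean energy, compactness of odd minimising
# sequences, and `L²` bookkeeping for folded limits

Support file for item stmt-RiemannHypothesis-17781 (`OddArchAnchor`) of route `OddSector`.
Normalisation of `Literature/NumberTheory/LFunctions/WeilExplicit.lean` and
`WeilMarkovQuadratic.lean`: `Q₀(g) := Re W_∞(g ⋆ g̃) = Re weilArchTerm (weilConv g (weilReflect g))`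
(the archimedean part of Weil's quadratic functional alone), increments `D_t = weilIncrement`,
archimedean density `ρ = weilArchDensity`.

## Contents (everything proved)

* `weilArchTerm_weilConv_weilReflect_re`: **the archimedean energy identity**
  `Q₀(g) = ∫₀^∞ ρ(t) D_t(g) dt − c₀ ∫|g|²`, `c₀ = 2∫₀^∞ (e^{t/2} − 1)/(2 sinh t) dt + log 4π + γ`
  (Bombieri's form of the archimedean term, `weilArchTermBombieri_eq_weilArchTerm_holds`, with the
  kernel-through-increments identity `k(t) + k(−t) = 2‖g‖² − D_t(g)` of `WeilMarkovQuadratic`);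
  hence `Q₀` is bounded below on the unit sphere and a pure-jump Dirichlet form up to a constant.
* `exists_oddArchMinimizingSeq_tendsto`: **compactness** — for every window `a > 0` there is an
  `L²`-normalised sequence of ODD window test functions which is `Q₀`-minimising in the odd sector
  and converges in `L²` (a minimising sequence exists; along it `Re Q = P + primes + Q₀ + const` is
  bounded, so the Connes–Consani–Moscovici compactness `ConnesConsaniMoscovici2025_thm_3_6_holds`
  extracts an `L²`-convergent subsequence).
* `L²` bookkeeping for the antisymmetric fold `x ↦ sign(x) |u(x)|` of an `L²` function
  (`Real.sign` facts reused from `Literature.Analysis.FunctionSpaces.BMOInv`).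

## References

* E. Bombieri, *Remarks on Weil's quadratic functional in the theory of prime numbers I*, Rend.
  Mat. Acc. Lincei (9) 11 (2000), Thm 2 (archimedean term) and §4 (variational theory).
* A. Connes, C. Consani, H. Moscovici, *Zeta spectral triples*, arXiv:2511.22755, Thm 3.6.
-/

-- `Summit.RiemannHypothesis.RiemannHypothesis.…` repeats the summit name by design (D-0017 layout).
set_option linter.dupNamespace false

noncomputable section

open MeasureTheory Set Filter
open scoped Topology ENNReal ArithmeticFunction.vonMangoldt

namespace Summit.RiemannHypothesis.RiemannHypothesis.Theorems.OddArchAnchor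

open Literature.NumberTheory.LFunctions
open Summit.RiemannHypothesis.RiemannHypothesis.Theorems.WeilGroundStateMarkovPart

variable {g : ℝ → ℂ} {a : ℝ}

/-! ## The archimedean energy identity -/

/-- **The archimedean energy identity.** For a test function `g`,
`Re W_∞(g ⋆ g̃) = ∫₀^∞ ρ(t) D_t(g) dt − c₀ ∫ |g|²` with
`c₀ = 2 ∫₀^∞ (e^{t/2} − 1)/(2 sinh t) dt + log 4π + γ` (Bombieri's archimedean term through
increments). -/
theorem weilArchTerm_weilConv_weilReflect_re (hg : IsWeilTest g) :
    (weilArchTerm (weilConv g (weilReflect g))).re =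
      (∫ t in Ioi (0 : ℝ), weilArchDensity t * weilIncrement g t) -
        (2 * (∫ t in Ioi (0 : ℝ), (Real.exp (t / 2) - 1) / (2 * Real.sinh t)) +
          (Real.log (4 * Real.pi) + Real.eulerMascheroniConstant)) * ∫ x, ‖g x‖ ^ 2 := by
  have hk : IsWeilTest (weilConv g (weilReflect g)) := hg.weilConv hg.weilReflect
  rw [← weilArchTermBombieri_eq_weilArchTerm_holds hk, weilArchTermBombieri_weilConv_weilReflect hg,
    Complex.ofReal_re, integral_bombieriIntegrand_eq_sub hg]
  ring

/-- The archimedean energy is non-negative. -/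
theorem archEnergy_nonneg (f : ℝ → ℂ) :
    0 ≤ ∫ t in Ioi (0 : ℝ), weilArchDensity t * weilIncrement f t :=
  setIntegral_nonneg measurableSet_Ioi fun t ht ↦
    mul_nonneg (weilArchDensity_pos ht).le (weilIncrement_nonneg f t)

/-- Homogeneity: the archimedean energy of `c · h` is `|c|²` times that of `h`. -/
theorem archEnergy_const_mul (c : ℂ) (h : ℝ → ℂ) :
    (∫ t in Ioi (0 : ℝ), weilArchDensity t * weilIncrement (fun x ↦ c * h x) t) =
      ‖c‖ ^ 2 * ∫ t in Ioi (0 : ℝ), weilArchDensity t * weilIncrement h t := by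
  simp only [weilIncrement_const_mul, ← integral_const_mul]
  exact integral_congr_ae (Eventually.of_forall fun t ↦ by ring)

/-! ## The odd unit sphere of the window: the values of `Q₀` -/

/-- The values of `Q₀` on the odd unit sphere of the window form a non-empty set for `a > 0`. -/
theorem oddArchSet_nonempty (ha : 0 < a) :
    {x : ℝ | ∃ f : ℝ → ℂ, IsWeilTest f ∧ tsupport f ⊆ Icc (-a) a ∧ (∀ t, f (-t) = -f t) ∧
      ∫ t, ‖f t‖ ^ 2 = (1 : ℝ) ∧ x = (weilArchTerm (weilConv f (weilReflect f))).re}.Nonempty := by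
  obtain ⟨f, hf, hsupp, hodd, hnorm⟩ := exists_isWeilTest_odd_sphere ha
  exact ⟨_, f, hf, hsupp, hodd, hnorm, rfl⟩

/-- The values of `Q₀` on the odd unit sphere are bounded below by `−c₀` (the energy is `≥ 0`). -/
theorem oddArchSet_bddBelow (a : ℝ) :
    BddBelow {x : ℝ | ∃ f : ℝ → ℂ, IsWeilTest f ∧ tsupport f ⊆ Icc (-a) a ∧ (∀ t, f (-t) = -f t) ∧
      ∫ t, ‖f t‖ ^ 2 = (1 : ℝ) ∧ x = (weilArchTerm (weilConv f (weilReflect f))).re} := by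
  refine ⟨-(2 * (∫ t in Ioi (0 : ℝ), (Real.exp (t / 2) - 1) / (2 * Real.sinh t)) +
    (Real.log (4 * Real.pi) + Real.eulerMascheroniConstant)), ?_⟩
  rintro x ⟨f, hf, -, -, hn, rfl⟩
  rw [weilArchTerm_weilConv_weilReflect_re hf, hn, mul_one]
  linarith [archEnergy_nonneg f]

/-! ## Compactness: an `L²`-convergent odd minimising sequence -/

/-- **Compactness of odd `Q₀`-minimising sequences.** For every window `a > 0` there are odd,
`L²`-normalised window test functions `gₙ` with `Q₀(gₙ) → inf Q₀` (infimum over the odd unit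
sphere of the window) which converge in `L²` to some `u ∈ L²`. -/
theorem exists_oddArchMinimizingSeq_tendsto (ha : 0 < a) :
    ∃ (g : ℕ → ℝ → ℂ) (u : ℝ → ℂ),
      (∀ n, IsWeilTest (g n) ∧ tsupport (g n) ⊆ Icc (-a) a ∧ (∀ t, g n (-t) = -g n t) ∧
        ∫ t, ‖g n t‖ ^ 2 = (1 : ℝ)) ∧
      Tendsto (fun n ↦ (weilArchTerm (weilConv (g n) (weilReflect (g n)))).re) atTop
        (𝓝 (sInf {x : ℝ | ∃ f : ℝ → ℂ, IsWeilTest f ∧ tsupport f ⊆ Icc (-a) a ∧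
          (∀ t, f (-t) = -f t) ∧ ∫ t, ‖f t‖ ^ 2 = (1 : ℝ) ∧
          x = (weilArchTerm (weilConv f (weilReflect f))).re})) ∧
      MemLp u 2 ∧ Tendsto (fun n ↦ ∫ t, ‖g n t - u t‖ ^ 2) atTop (𝓝 0) := by
  set S : Set ℝ := {x : ℝ | ∃ f : ℝ → ℂ, IsWeilTest f ∧ tsupport f ⊆ Icc (-a) a ∧
    (∀ t, f (-t) = -f t) ∧ ∫ t, ‖f t‖ ^ 2 = (1 : ℝ) ∧
    x = (weilArchTerm (weilConv f (weilReflect f))).re} with hS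
  set c₀ : ℝ := 2 * (∫ t in Ioi (0 : ℝ), (Real.exp (t / 2) - 1) / (2 * Real.sinh t)) +
    (Real.log (4 * Real.pi) + Real.eulerMascheroniConstant) with hc₀
  -- a minimising sequence
  obtain ⟨x, -, hx, hmem⟩ := exists_seq_tendsto_sInf (oddArchSet_nonempty ha) (oddArchSet_bddBelow a)
  have hmem' : ∀ n, ∃ f : ℝ → ℂ, IsWeilTest f ∧ tsupport f ⊆ Icc (-a) a ∧ (∀ t, f (-t) = -f t) ∧
      ∫ t, ‖f t‖ ^ 2 = (1 : ℝ) ∧ x n = (weilArchTerm (weilConv f (weilReflect f))).re := hmem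
  choose g hg hsupp hodd hnorm hxg using hmem'
  have hQ : Tendsto (fun n ↦ (weilArchTerm (weilConv (g n) (weilReflect (g n)))).re) atTop
      (𝓝 (sInf S)) := by
    have hfun : (fun n ↦ (weilArchTerm (weilConv (g n) (weilReflect (g n)))).re) = x :=
      funext fun n ↦ (hxg n).symm
    rw [hfun]
    exact hx
  -- `Re Q` is bounded above along the sequence
  have hbdd : BddAbove (Set.range fun n ↦ (weilQuadratic (g n)).re) := by
    obtain ⟨B, hB⟩ := hQ.bddAbove_range
    refine ⟨4 * a * Real.exp (2 * a) + 4 * (∑ n ∈ weilPrimeIndex a, (Λ n : ℝ) / Real.sqrt n) +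
      (B + c₀) - weilMarkovConstant a, ?_⟩
    rintro _ ⟨n, rfl⟩
    have hdec := weilQuadratic_re_eq_weilPoleForm_add_weilDirichletEnergy_sub (hg n) (hsupp n)
    rw [hnorm n, mul_one] at hdec
    have hP := weilPoleForm_le_of_sphere ha (hg n) (hsupp n) (hnorm n)
    have hprime : (∑ k ∈ weilPrimeIndex a, (Λ k : ℝ) / Real.sqrt k * weilIncrement (g n) (Real.log k))
        ≤ 4 * ∑ k ∈ weilPrimeIndex a, (Λ k : ℝ) / Real.sqrt k := by
      rw [Finset.mul_sum]
      refine Finset.sum_le_sum fun k _ ↦ ?_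
      have hD := weilIncrement_le (hg n) (Real.log k)
      rw [hnorm n, mul_one] at hD
      have hc : 0 ≤ (Λ k : ℝ) / Real.sqrt k :=
        div_nonneg ArithmeticFunction.vonMangoldt_nonneg (Real.sqrt_nonneg _)
      calc (Λ k : ℝ) / Real.sqrt k * weilIncrement (g n) (Real.log k)
          ≤ (Λ k : ℝ) / Real.sqrt k * 4 := mul_le_mul_of_nonneg_left hD hc
        _ = 4 * ((Λ k : ℝ) / Real.sqrt k) := by ring
    have hE : (∫ t in Ioi (0 : ℝ), weilArchDensity t * weilIncrement (g n) t) ≤ B + c₀ := by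
      have h1 : (weilArchTerm (weilConv (g n) (weilReflect (g n)))).re ≤ B := hB ⟨n, rfl⟩
      rw [weilArchTerm_weilConv_weilReflect_re (hg n), hnorm n, mul_one] at h1
      linarith
    have hsplit : weilDirichletEnergy a (g n) =
        (∑ k ∈ weilPrimeIndex a, (Λ k : ℝ) / Real.sqrt k * weilIncrement (g n) (Real.log k)) +
          ∫ t in Ioi (0 : ℝ), weilArchDensity t * weilIncrement (g n) t := rfl
    simp only
    linarith
  -- compactness
  obtain ⟨u, hu, φ, hφ, hlim⟩ := ConnesConsaniMoscovici2025_thm_3_6_holds a ha g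
    (fun n ↦ ⟨hg n, hsupp n, hnorm n⟩) hbdd
  exact ⟨fun n ↦ g (φ n), u, fun n ↦ ⟨hg _, hsupp _, hodd _, hnorm _⟩, hQ.comp hφ.tendsto_atTop,
    hu, hlim⟩

/-! ## `L²` bookkeeping for the antisymmetric fold `sign · |u|` -/

/-- `|sign x| = 1` for `x ≠ 0`. -/
theorem abs_real_sign_of_ne_zero {x : ℝ} (hx : x ≠ 0) : |Real.sign x| = 1 := by
  rcases Real.sign_apply_eq_of_ne_zero x hx with h | h <;> rw [h] <;> norm_num

/-- The antisymmetric fold `x ↦ sign(x) |u(x)|` of an `L²` function is in `L²`. -/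
theorem memLp_signFold {u : ℝ → ℂ} (hu : MemLp u 2) :
    MemLp (fun x ↦ (((Real.sign x * ‖u x‖ : ℝ)) : ℂ)) 2 := by
  refine hu.of_le ?_ (Eventually.of_forall fun x ↦ ?_)
  · exact Complex.continuous_ofReal.comp_aestronglyMeasurable
      (Literature.Analysis.FunctionSpaces.BMOInv.measurable_real_sign.aestronglyMeasurable.mul
        hu.1.norm)
  · rw [Complex.norm_real, Real.norm_eq_abs, abs_mul, abs_norm]
    calc |Real.sign x| * ‖u x‖ ≤ 1 * ‖u x‖ :=
        mul_le_mul_of_nonneg_right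
          (Literature.Analysis.FunctionSpaces.BMOInv.abs_real_sign_le_one x) (norm_nonneg _)
      _ = ‖u x‖ := one_mul _

/-- The fold preserves the `L²` norm: `∫ |sign(x) |u(x)||² dx = ∫ |u|²` (the origin is null). -/
theorem integral_norm_sq_signFold (u : ℝ → ℂ) :
    ∫ x, ‖(((Real.sign x * ‖u x‖ : ℝ)) : ℂ)‖ ^ 2 = ∫ x, ‖u x‖ ^ 2 := by
  have hae : ∀ᵐ x : ℝ, x ≠ 0 := by
    rw [ae_iff]
    simp
  refine integral_congr_ae (hae.mono fun x hx ↦ ?_)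
  simp only
  rw [Complex.norm_real, Real.norm_eq_abs, abs_mul, abs_norm, abs_real_sign_of_ne_zero hx, one_mul]

/-- The fold is an `L²`-contraction pointwise: `|sign(x)|g(x)| − sign(x)|u(x)|| ≤ |g(x) − u(x)|`. -/
theorem norm_signFold_sub_le (g u : ℝ → ℂ) (x : ℝ) :
    ‖(((Real.sign x * ‖g x‖ : ℝ)) : ℂ) - (((Real.sign x * ‖u x‖ : ℝ)) : ℂ)‖ ≤ ‖g x - u x‖ := by
  rw [← Complex.ofReal_sub, Complex.norm_real, Real.norm_eq_abs, ← mul_sub, abs_mul]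
  calc |Real.sign x| * |‖g x‖ - ‖u x‖| ≤ 1 * ‖g x - u x‖ :=
      mul_le_mul (Literature.Analysis.FunctionSpaces.BMOInv.abs_real_sign_le_one x)
        (abs_norm_sub_norm_le _ _) (abs_nonneg _) zero_le_one
    _ = ‖g x - u x‖ := one_mul _

/-- A uniformly bounded function vanishing off `[-a, a]` has `∫ |F|² ≤ C² · 2a`. -/
theorem integral_norm_sq_le_of_window {F : ℝ → ℂ} {a C : ℝ} (ha : 0 ≤ a)
    (hF : ∀ x, ‖F x‖ ≤ C) (hF0 : ∀ x, x ∉ Icc (-a) a → F x = 0) :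
    ∫ x, ‖F x‖ ^ 2 ≤ C ^ 2 * (2 * a) := by
  have hdom : Integrable ((Icc (-a) a).indicator fun _ : ℝ ↦ C ^ 2) :=
    (integrableOn_const (μ := volume) (s := Icc (-a) a) (C := C ^ 2)
      (measure_Icc_lt_top).ne).integrable_indicator measurableSet_Icc
  calc ∫ x, ‖F x‖ ^ 2 ≤ ∫ x, (Icc (-a) a).indicator (fun _ : ℝ ↦ C ^ 2) x := by
        refine integral_mono_of_nonneg (Eventually.of_forall fun x ↦ by positivity) hdom
          (Eventually.of_forall fun x ↦ ?_)
        show ‖F x‖ ^ 2 ≤ (Icc (-a) a).indicator (fun _ : ℝ ↦ C ^ 2) x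
        by_cases hx : x ∈ Icc (-a) a
        · rw [indicator_of_mem hx]
          exact pow_le_pow_left₀ (norm_nonneg _) (hF x) 2
        · rw [indicator_of_notMem hx, hF0 x hx, norm_zero]
          simp
    _ = C ^ 2 * (2 * a) := by
        rw [integral_indicator_const _ measurableSet_Icc, Real.volume_real_Icc_of_le (by linarith),
          smul_eq_mul]
        ring

end Summit.RiemannHypothesis.RiemannHypothesis.Theorems.OddArchAnchor

end
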